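import Summits.ValiantsHypothesis.ValiantsHypothesis.Theses.ProjectionRigidity
import Summits.ValiantsHypothesis.ValiantsHypothesis.Theorems.GrenetRigidityOptimalUniqueRefutation
import Literature.Computability.AlgebraicComplexity.GrenetProjection
import Literature.Uncategorized.ProjOptimalUniqueWithoutPure

/-!
# Crux `ProjOptimalUnique` (stmt-ValiantsHypothesis-16001) — load-bearing hypothesis No. 1: PURITY

Negative lemma for the crux `ProjectionRigidity.ProjOptimalUnique` (disprover seat, cycle 1).

The crux says: for `n ≥ 3`, any two `m × m` matrices `A, B` (`m = pdc(per_n)`) whose entries are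
single variables `X v` or constants `C c` ("pure" Valiant projections) and whose determinant is
`per_n` are equivalent under constant gauge, the realised symmetries of `per_n` and transposition.
Here we record, as a kernel-checked fact, that the PURITY hypothesis is load-bearing: the same
statement with "pure" weakened to "affine" (`IsAffineDetRepr`: entries of total degree `≤ 1`,
`det = per_n`) — `ProjOptimalUniqueWithoutPure` below — is FALSE.  At `n = 3` the size is
`pdc(per₃) = 7` (tree: `detProjectionComplexity_perPoly_three`, Alper–Bogart–Velasco 2017 Cor. 1.4 +
Grenet 2011), so the level-3 instance is literally the refuted `GrenetRigidity.OptimalUniqueThree`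
(tree: `GrenetRigidityOptimalUniqueThree_refuted` — Grenet's matrix versus its Koszul twist
`A · (1 + D)`, separated by the rank of a coefficient matrix).

So any proof of the crux must use that BOTH matrices are pure, not merely affine: the refuting twist
has two-variable cells.  (The converse bookkeeping — pure entries are affine, so
`ProjOptimalUniqueWithoutPure → ProjOptimalUnique` — is immediate and deliberately not stated here:
files on the negative lane carry no positive conclusion about a Theses declaration.)

References: Alper–Bogart–Velasco 2017, Cor. 1.4; Grenet 2011, Thm. 1; Hüttenhain–Ikenmeyer 2016,
Prop. 9 (binary case of uniqueness at `n = 3`).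
-/

noncomputable section

-- single-conjunct layout: Sub = Summit, duplicated namespace component intended
set_option linter.dupNamespace false

namespace Summit.ValiantsHypothesis.ValiantsHypothesis.Theorems.ProjOptimalUnique.Negative

open Literature.Computability.AlgebraicComplexity

/-- **Purity is load-bearing**: the affine weakening `ProjOptimalUniqueWithoutPure` of the crux is
false.  Transport along `pdc(per₃) = 7`; the level-3 instance is `GrenetRigidity.OptimalUniqueThree`,
refuted in the tree by Grenet's matrix and its affine Koszul twist. [folklore] -/
theorem projOptimalUnique_false_without_pure : ¬ Literature.Uncategorized.ProjOptimalUniqueWithoutPure := by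
  intro h
  have h3 := h 3 le_rfl
  revert h3
  rw [detProjectionComplexity_perPoly_three]
  exact Summit.ValiantsHypothesis.Theorems.GrenetRigidityOptimalUniqueThree_refuted

end Summit.ValiantsHypothesis.ValiantsHypothesis.Theorems.ProjOptimalUnique.Negative

end
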